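import Summits.CriticalPhenomena.PercolationContinuityZ3.Theorems.PercNearOneGluingNoHeavyPcintKernZ6S4Check1
import Summits.CriticalPhenomena.PercolationContinuityZ3.Theorems.PercNearOneGluingNoHeavyPcintKernZ6S4Check2
import Summits.CriticalPhenomena.PercolationContinuityZ3.Theorems.PercNearOneGluingNoHeavyPcintKernZ6S4Check3
import Summits.CriticalPhenomena.PercolationContinuityZ3.Theorems.PercNearOneGluingNoHeavyPcintKernZ6S4Check4
import HarnessLib

/-!
# PCINT lane: `p_c^site(ℤ⁶) ≥ 0.0995` (kernel-checked B2r window certificate, memory 4 (3-step windows, 1728 codes); the tree's previous kernel bound is the memory-4 closed form `1/((d-1)+√((d-1)²+1)) = 0.0990`; printed lower bound = the bond one).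

Cell `prim-pcint`, seat `prim-pcint-2` (gen 2); memo `run/shared/lean/prim/pcint/INTERVAL-PLAN.md` §14.  Does NOT build on p205010.
Assembles the kernel-checked chunks (`…KernZ6S4Check1..4`) and applies the generic certificate theorem
`WinK.le_siteCriticalProb_of_checkS` (`…PcintWinKernelCert`).  No external certificate, no
`native_decide`; axioms standard.  (The lane's two-implementation certificates reach further at larger memory; this is the kernel-only row.)
-/

namespace Summit.CriticalPhenomena.PercolationContinuityZ3.Theorems.Pcint

open Literature.Probability.Percolation Literature.Probability.LatticeModels Z6S4

/-- All `1728` coded Collatz–Wielandt rows check. [folklore] -/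
theorem Z6S4.chkAll : chk 0 1728 = true :=
  chk_split (chk_split (chk_split chkFile_1 chkFile_2) chkFile_3) chkFile_4

/-- **`p_c^site(ℤ⁶) ≥ 0.0995`** (kernel-checked B2r window certificate, memory 4 (3-step windows, 1728 codes); the tree's previous kernel bound is the memory-4 closed form `1/((d-1)+√((d-1)²+1)) = 0.0990`; printed lower bound = the bond one). [folklore] -/
theorem siteCriticalProb_Z6_ge_00995 : (0.0995 : ℝ) ≤ siteCriticalProb (zdGraph 6) 0 := by
  have h := WinK.le_siteCriticalProb_of_checkS (d := 6) (m := 2) (pn := 995) (Q := 9906) (lamN := 99999)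
      (tbl := tbl) (dflt := 90764) (vlo := 90764) (vhi := 100000) (by norm_num) (by norm_num) (by norm_num) (by norm_num)
      (by norm_num) tbl_bounds (by norm_num) (by norm_num) chkAll
  have e : ((995 : ℕ) : ℝ) / 10 ^ 4 = 0.0995 := by norm_num
  rw [e] at h
  exact h

end Summit.CriticalPhenomena.PercolationContinuityZ3.Theorems.Pcint
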